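import Summits.CriticalPhenomena.PercolationContinuityZ3.Theorems.Transplant.FKDoubleFanOneSidedRays
import HarnessLib

/-!
# Double fans `K₂ ∨ P_{m+1}`: the `Λ`-FLOOR version of the ray decomposition — honest fibre endpoints for inputs with `Λ ≥ 0`

Helper file (`--supports stmt-CriticalPhenomena-4575`), FK sub-lane `prim-bschramm-fk-3` (gen 37); builds on p205010 (kernel theorem, internal audit
signed; external expert review pending).  Pure real algebra, no sorries; standard axioms.  Memo `bschramm/prim-bschramm-fk-3/FAR-CROSS-XII.md` §4.

`…OneSidedRays` reduces a functional `Φ`, affine along the apex-`b` fibre coordinate `u₀`, on the class (masses `≥ 0`) ∧ `(U_b)` to the degenerate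
frame, the floor `u₀ = 0` and the roof points `roofV`.  For CONE-MEMBERSHIP statements (the closure statements `HypBaS`/`HypB` of `…OneSidedConeS`,
`…OneSidedDominance`) the floor `u₀ = 0` is useless: it violates `Λ ≥ 0`, its product rays `AC`, `BD` are not limits of products of valid inputs, and the
cells fail there (memo §4: margins `0.2–0.6`).  This file gives the honest version for inputs with `Λ = Z₀Z₁ − (Z_abZ_ac + Z_abZ_bc + Z_acZ_bc) ≥ 0`:
along the fibre, `Λ` is increasing in `u₀`, so the lower endpoint is the **`Λ`-floor** `u_Λ = (Xy + XZ + yZ)/(W − qy)` (**`vecB_nonneg_of_lamfloor`**,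
**`nonneg_of_lamfloor`**: hypotheses = degenerate frame, `Λ`-floor points, roof points).  Moreover the products of a `Λ`-floor point are an explicit CONVEX
combination — along the ruling `X = const` of the saddle — of the products of an `AB∗AC`-type point (`Z_bc = 0`, `Λ = 0`) and of an `AB∗BC`-type point
(`Z_ac = 0`, `Z₀Z₁ = Z_abZ_bc`): **`uprods_lamfloor_ruling`**.  Both are genuine two-letter product states of the three-apex monoid, so every functional
that is LINEAR in the products `uprods` is `≥ 0` on the whole class as soon as it is `≥ 0` on the degenerate frame, on the two-letter product states and on
the roof points (**`nonneg_of_twoletter_roof`**).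
[folklore]
-/

noncomputable section

namespace Summit.CriticalPhenomena.PercolationContinuityZ3.Theorems

namespace FK

namespace ThreeApex

/-! ### The fibre lemma with the `Λ`-floor -/

/-- `Λ` in the apex-`b` frame: `Λ(vecB q W y X Z u₀) = u₀(W − qy) − (Xy + XZ + yZ)`. [folklore] -/
theorem lam_vecB (q W y X Z u0 : ℝ) : lam (vecB q W y X Z u0) = u0 * (W - q * y) - (X * y + X * Z + y * Z) := by
  simp only [lam, vecB]; ring

/-- **Ray decomposition with the `Λ`-floor (apex-`b` frame).**  Let `Φ` be affine along `u₀`.  If `Φ ≥ 0` on the degenerate frame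
`vecB q (qy) y 0 0 u₀`, on every `Λ`-FLOOR point `vecB q W y X Z u_Λ` (`X, Z ≥ 0`, `0 ≤ u_Λ ≤ y`, `qy < W`, `Z_1 ≥ 0`, `u_Λ(W−qy) = Xy+XZ+yZ`) and on
every roof point `roofV q κ l t w`, then `Φ ≥ 0` at every point with masses `≥ 0`, `Λ ≥ 0` and `(U_b)` in coordinates (`0 < q < 1`). [folklore] -/
theorem vecB_nonneg_of_lamfloor {q : ℝ} (hq0 : 0 < q) (hq1 : q < 1) {Φ : V5 → ℝ}
    (haff : ∀ W y X Z a b c : ℝ,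
      Φ (vecB q W y X Z (c * a + (1 - c) * b)) = c * Φ (vecB q W y X Z a) + (1 - c) * Φ (vecB q W y X Z b))
    (hdeg : ∀ y u0 : ℝ, 0 ≤ u0 → u0 ≤ y → 0 ≤ Φ (vecB q (q * y) y 0 0 u0))
    (hlam : ∀ W y X Z uL : ℝ, 0 ≤ X → 0 ≤ Z → 0 ≤ uL → uL ≤ y → q * y < W → 0 ≤ W - q * y - X - Z →
      uL * (W - q * y) = X * y + X * Z + y * Z → 0 ≤ Φ (vecB q W y X Z uL))
    (hroof : ∀ κ l t w : ℝ, 0 ≤ κ → 0 < l → 0 ≤ t → 0 ≤ w → w ≤ 1 → 0 ≤ Φ (roofV q κ l t w))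
    {W y X Z u0 : ℝ} (hX : 0 ≤ X) (hZ : 0 ≤ Z) (hu0 : 0 ≤ u0) (hyu : u0 ≤ y) (h1 : 0 ≤ W - q * y - X - Z)
    (hΛ : X * y + X * Z + y * Z ≤ u0 * (W - q * y))
    (hUb : ∀ w : ℝ, 0 ≤ w → w ≤ 1 →
      (u0 * (W - q * y) - (X + Z) * y) * ((1 - q) + q * w * (1 - w)) ≤ W * (w ^ 2 * X + (1 - w) ^ 2 * Z)) :
    0 ≤ Φ (vecB q W y X Z u0) := by
  have hy0 : 0 ≤ y := hu0.trans hyu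
  rcases eq_or_lt_of_le (show q * y ≤ W by linarith) with hW | hW
  · have hX0 : X = 0 := by linarith
    have hZ0 : Z = 0 := by linarith
    subst hX0 hZ0 hW
    exact hdeg y u0 hu0 hyu
  · obtain ⟨w, ⟨hw0, hw1⟩, hRw⟩ : ∃ w ∈ Set.Icc (0:ℝ) 1,
        (fun w : ℝ => q * (X - Z) * w ^ 2 + 2 * ((1 - q) * X + Z) * w - (2 - q) * Z) w = 0 := by
      have hc : ContinuousOn (fun w : ℝ => q * (X - Z) * w ^ 2 + 2 * ((1 - q) * X + Z) * w - (2 - q) * Z) (Set.Icc 0 1) := by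
        fun_prop
      refine intermediate_value_Icc zero_le_one hc ⟨?_, ?_⟩
      · have : 0 ≤ (2 - q) * Z := by nlinarith
        show q * (X - Z) * 0 ^ 2 + 2 * ((1 - q) * X + Z) * 0 - (2 - q) * Z ≤ 0
        nlinarith
      · have : 0 ≤ (2 - q) * X := by nlinarith
        show 0 ≤ q * (X - Z) * 1 ^ 2 + 2 * ((1 - q) * X + Z) * 1 - (2 - q) * Z
        nlinarith
    have hN : 0 < (1 - q) + q * w * (1 - w) := probeN_pos hq0.le hq1 hw0 hw1
    have hWq : 0 < W - q * y := by linarith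
    have hden : (W - q * y) * ((1 - q) + q * w * (1 - w)) ≠ 0 := (mul_pos hWq hN).ne'
    -- the roof value above `(X, Z)`
    obtain ⟨uR, huR⟩ : ∃ uR : ℝ, uR = ((X + Z) * y * ((1 - q) + q * w * (1 - w)) + W * (w ^ 2 * X + (1 - w) ^ 2 * Z)) /
        ((W - q * y) * ((1 - q) + q * w * (1 - w))) := ⟨_, rfl⟩
    have hmul : uR * ((W - q * y) * ((1 - q) + q * w * (1 - w))) =
        (X + Z) * y * ((1 - q) + q * w * (1 - w)) + W * (w ^ 2 * X + (1 - w) ^ 2 * Z) := by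
      rw [huR]; exact div_mul_cancel₀ _ hden
    have hT : (uR * (W - q * y) - (X + Z) * y) * ((1 - q) + q * w * (1 - w)) = W * (w ^ 2 * X + (1 - w) ^ 2 * Z) := by
      linear_combination hmul
    have hle : u0 ≤ uR := by
      by_contra hc
      have hc := not_le.1 hc
      have h2 : (uR * (W - q * y) - (X + Z) * y) * ((1 - q) + q * w * (1 - w)) <
          (u0 * (W - q * y) - (X + Z) * y) * ((1 - q) + q * w * (1 - w)) :=
        mul_lt_mul_of_pos_right (by nlinarith [mul_lt_mul_of_pos_right hc hWq]) hN
      linarith [hUb w hw0 hw1]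
    -- the `Λ`-floor value below `(X, Z)`
    obtain ⟨uL, huL⟩ : ∃ uL : ℝ, uL = (X * y + X * Z + y * Z) / (W - q * y) := ⟨_, rfl⟩
    have hLmul : uL * (W - q * y) = X * y + X * Z + y * Z := by rw [huL]; exact div_mul_cancel₀ _ hWq.ne'
    have hL0 : 0 ≤ uL := by rw [huL]; exact div_nonneg (by positivity) hWq.le
    have hLle : uL ≤ u0 := by
      by_contra hc
      have hc := not_le.1 hc
      have := mul_lt_mul_of_pos_right hc hWq
      linarith
    have hfl : 0 ≤ Φ (vecB q W y X Z uL) := hlam W y X Z uL hX hZ hL0 (hLle.trans hyu) hW h1 hLmul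
    rcases eq_or_lt_of_le (hLle.trans hle) with hRL | hRL
    · -- collapsed fibre: `u₀ = u_Λ = u_R`
      have hu : u0 = uL := le_antisymm (hRL ▸ hle) hLle
      rw [hu]; exact hfl
    · obtain ⟨κ, l, t, hκ, hl, ht, hv⟩ := exists_roof_param hq0.le hq1 hW hy0 hX hZ hw0 hw1 hRw hT
      have hrf : 0 ≤ Φ (vecB q W y X Z uR) := by rw [hv]; exact hroof κ l t w hκ hl ht hw0 hw1
      have hgap : 0 < uR - uL := sub_pos.2 hRL
      have hsplit : u0 = (u0 - uL) / (uR - uL) * uR + (1 - (u0 - uL) / (uR - uL)) * uL := by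
        field_simp
        ring
      rw [hsplit, haff]
      have hc0 : 0 ≤ (u0 - uL) / (uR - uL) := div_nonneg (sub_nonneg.2 hLle) hgap.le
      have hc1 : (u0 - uL) / (uR - uL) ≤ 1 := (div_le_one hgap).2 (by linarith)
      exact add_nonneg (mul_nonneg hc0 hrf) (mul_nonneg (sub_nonneg.2 hc1) hfl)

/-- **`Λ`-floor ray decomposition for a vector with masses `≥ 0`, `Λ ≥ 0` and `(U_b)`** (`0 < q < 1`). [folklore] -/
theorem nonneg_of_lamfloor {q : ℝ} (hq0 : 0 < q) (hq1 : q < 1) {Φ : V5 → ℝ}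
    (haff : ∀ W y X Z a b c : ℝ,
      Φ (vecB q W y X Z (c * a + (1 - c) * b)) = c * Φ (vecB q W y X Z a) + (1 - c) * Φ (vecB q W y X Z b))
    (hdeg : ∀ y u0 : ℝ, 0 ≤ u0 → u0 ≤ y → 0 ≤ Φ (vecB q (q * y) y 0 0 u0))
    (hlam : ∀ W y X Z uL : ℝ, 0 ≤ X → 0 ≤ Z → 0 ≤ uL → uL ≤ y → q * y < W → 0 ≤ W - q * y - X - Z →
      uL * (W - q * y) = X * y + X * Z + y * Z → 0 ≤ Φ (vecB q W y X Z uL))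
    (hroof : ∀ κ l t w : ℝ, 0 ≤ κ → 0 < l → 0 ≤ t → 0 ≤ w → w ≤ 1 → 0 ≤ Φ (roofV q κ l t w))
    {Z : V5} (hZ : Z.Nonneg) (hL : 0 ≤ lam Z) (hU : UCond q (swapAB Z)) : 0 ≤ Φ Z := by
  obtain ⟨h0, hab, hac, hbc, h1⟩ := hZ
  have hΛ : Z.zab * (Z.z0 + Z.zac) + Z.zab * Z.zbc + (Z.z0 + Z.zac) * Z.zbc ≤
      Z.z0 * ((Z.total - (1 - q) * (Z.z0 + Z.zac)) - q * (Z.z0 + Z.zac)) := by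
    simp only [lam, V5.total] at hL ⊢; nlinarith [hL]
  have key := vecB_nonneg_of_lamfloor hq0 hq1 haff hdeg hlam hroof (W := Z.total - (1 - q) * (Z.z0 + Z.zac))
    (y := Z.z0 + Z.zac) hab hbc h0 (by linarith) (by simp only [V5.total]; linarith) hΛ (by
      intro w hw0 hw1
      have := uCondB_coord hU w hw0 hw1
      linarith)
  rwa [vecB_eta] at key

/-! ### The ruling decomposition of the `Λ`-floor -/

/-- **The `Λ`-floor point lies on a ruling between two two-letter product states.**  For `qy < W`, `0 < X + y` and the `Λ`-floor value
`u_Λ = (Xy + XZ + yZ)/(W − qy)`, with `Z″ = y(W − qy − X)/(X + y)` (the value of `Z_bc` at which the floor reaches the top `u_Λ = y`):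
`uprods (vecB q W y X Z u_Λ) = (1 − Z/Z″)·uprods (vecB q W y X 0 (Xy/(W−qy))) + (Z/Z″)·uprods (vecB q W y X Z″ y)`; the first point has
`Z_bc = 0 ∧ Λ = 0` (an `AB∗AC`-type state), the second `Z_ac = 0 ∧ Z₀Z₁ = Z_abZ_bc` (an `AB∗BC`-type state). [folklore] -/
theorem uprods_lamfloor_ruling {q W y X Z : ℝ} (hX : 0 ≤ X) (hy0 : 0 < y) (hX1 : X < W - q * y) :
    uprods (vecB q W y X Z ((X * y + X * Z + y * Z) / (W - q * y))) =
      P6.add (P6.smul (1 - Z / (y * (W - q * y - X) / (X + y))) (uprods (vecB q W y X 0 (X * y / (W - q * y)))))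
        (P6.smul (Z / (y * (W - q * y - X) / (X + y))) (uprods (vecB q W y X (y * (W - q * y - X) / (X + y)) y))) := by
  -- clear the denominators `l = W − qy`, `X + y`, `l − X`
  obtain ⟨l, hl⟩ : ∃ l : ℝ, l = W - q * y := ⟨_, rfl⟩
  have hl0 : l ≠ 0 := by rw [hl]; linarith
  have hm0 : l - X ≠ 0 := by rw [hl]; linarith
  have hs0 : X + y ≠ 0 := by linarith
  have hy1 : y ≠ 0 := hy0.ne'
  ext <;> simp only [uprods, vecB, P6.add, P6.smul, hx, ThreeApex.hy, hz, V5.total, ← hl] <;> field_simp <;> ring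

/-- The `AB∗AC`-type endpoint of the ruling has `Z_bc = 0` and `Λ = 0`. [folklore] -/
theorem lamfloor_ruling_left {q W y X : ℝ} (hW : q * y < W) :
    (vecB q W y X 0 (X * y / (W - q * y))).zbc = 0 ∧ lam (vecB q W y X 0 (X * y / (W - q * y))) = 0 := by
  refine ⟨rfl, ?_⟩
  obtain ⟨l, hl⟩ : ∃ l : ℝ, l = W - q * y := ⟨_, rfl⟩
  have hl0 : l ≠ 0 := by rw [hl]; linarith
  rw [lam_vecB, ← hl]
  field_simp
  ring

/-- The `AB∗BC`-type endpoint of the ruling has `Z_ac = 0` and `Λ = 0` (i.e. `Z₀Z₁ = Z_abZ_bc`). [folklore] -/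
theorem lamfloor_ruling_right {q W y X : ℝ} (hXy : 0 < X + y) :
    (vecB q W y X (y * (W - q * y - X) / (X + y)) y).zac = 0 ∧ lam (vecB q W y X (y * (W - q * y - X) / (X + y)) y) = 0 := by
  refine ⟨by simp only [vecB]; ring, ?_⟩
  have hs0 : X + y ≠ 0 := hXy.ne'
  rw [lam_vecB]
  field_simp
  ring

/-- The ruling coefficient is a convex weight: for a `Λ`-floor point below the top (`u_Λ ≤ y`, i.e. `Xy + XZ + yZ ≤ y(W − qy)`) one has
`0 ≤ Z/Z″ ≤ 1`. [folklore] -/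
theorem lamfloor_ruling_weight {q W y X Z : ℝ} (hXy : 0 < X + y) (hy : 0 < y) (hX1 : X < W - q * y) (hZ : 0 ≤ Z)
    (htop : X * y + X * Z + y * Z ≤ y * (W - q * y)) :
    0 ≤ Z / (y * (W - q * y - X) / (X + y)) ∧ Z / (y * (W - q * y - X) / (X + y)) ≤ 1 := by
  have hZ'' : 0 < y * (W - q * y - X) / (X + y) := div_pos (mul_pos hy (by linarith)) hXy
  refine ⟨div_nonneg hZ hZ''.le, (div_le_one hZ'').2 ?_⟩
  rw [le_div_iff₀ hXy]
  nlinarith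

/-! ### Assembly: functionals linear in the products -/

/-- **Two-letter states and roof points suffice.**  Let `Φ v = L (uprods v)` with `L` linear.  If `Φ ≥ 0` on the degenerate frame, on the
`AB∗AC`-type states `vecB q W y X 0 (Xy/(W−qy))` (`X, y ≥ 0`, `qy < W`, `X ≤ W − qy`), on the `AB∗BC`-type states `vecB q W y X Z y` with
`y(W − qy − X − Z) = XZ` (`X, Z ≥ 0`, `y ≥ 0`, `Z ≤ W − qy − X`) and on the roof points, then `Φ ≥ 0` at every vector with masses `≥ 0`, `Λ ≥ 0` and `(U_b)`
(`0 < q < 1`). [folklore] -/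
theorem nonneg_of_twoletter_roof {q : ℝ} (hq0 : 0 < q) (hq1 : q < 1) {L : P6 → ℝ}
    (hL : ∀ (a b : ℝ) (P Q : P6), L (P6.add (P6.smul a P) (P6.smul b Q)) = a * L P + b * L Q)
    (hdeg : ∀ y u0 : ℝ, 0 ≤ u0 → u0 ≤ y → 0 ≤ L (uprods (vecB q (q * y) y 0 0 u0)))
    (hAC : ∀ W y X : ℝ, 0 ≤ X → 0 ≤ y → q * y < W → X ≤ W - q * y → 0 ≤ L (uprods (vecB q W y X 0 (X * y / (W - q * y)))))
    (hBC : ∀ W y X Z : ℝ, 0 ≤ X → 0 ≤ Z → 0 ≤ y → q * y < W → Z ≤ W - q * y - X → y * (W - q * y - X - Z) = X * Z →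
      0 ≤ L (uprods (vecB q W y X Z y)))
    (hroof : ∀ κ l t w : ℝ, 0 ≤ κ → 0 < l → 0 ≤ t → 0 ≤ w → w ≤ 1 → 0 ≤ L (uprods (roofV q κ l t w)))
    {Z : V5} (hZ : Z.Nonneg) (hΛ : 0 ≤ lam Z) (hU : UCond q (swapAB Z)) : 0 ≤ L (uprods Z) := by
  have hsm : ∀ (a : ℝ) (P : P6), L (P6.smul a P) = a * L P := by
    intro a P
    have h := hL a 0 P P
    have e : P6.add (P6.smul a P) (P6.smul 0 P) = P6.smul a P := by
      ext <;> simp only [P6.add, P6.smul, zero_mul, add_zero]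
    rw [e] at h; linarith
  refine nonneg_of_lamfloor hq0 hq1 (Φ := fun v => L (uprods v)) ?_ hdeg ?_ hroof hZ hΛ hU
  · -- affinity along the fibre: `uprods` is affine in `u₀` and `L` is linear
    intro W y X Z a b c
    have e : uprods (vecB q W y X Z (c * a + (1 - c) * b)) =
        P6.add (P6.smul c (uprods (vecB q W y X Z a))) (P6.smul (1 - c) (uprods (vecB q W y X Z b))) := by
      ext <;> simp only [uprods, vecB, P6.add, P6.smul, hx, hy, hz, V5.total] <;> ring
    show L _ = c * L _ + (1 - c) * L _
    rw [e, hL]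
  · intro W y X Z uL hX hZ0 hL0 hLy hW h1 hfl
    have hl : 0 < W - q * y := by linarith
    have hy0 : 0 ≤ y := hL0.trans hLy
    have huL : uL = (X * y + X * Z + y * Z) / (W - q * y) := by rw [eq_div_iff hl.ne']; exact hfl
    show 0 ≤ L (uprods (vecB q W y X Z uL))
    -- edge cases: `y = 0` or `X = W − qy` — the floor point is itself an `AB∗AC`-type state
    rcases eq_or_lt_of_le hy0 with hy00 | hyp
    · subst hy00
      have hXZ : X * Z = 0 := by nlinarith
      have hu0 : uL = 0 := by nlinarith
      rcases mul_eq_zero.1 hXZ with hX0 | hZ00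
      · subst hX0
        -- `X = y = 0`: the point `(0,0,0,Z,Z₁)`; its products vanish except ... use the `AB∗BC` family with `y = 0`
        have := hBC W 0 0 Z le_rfl hZ0 le_rfl hW (by linarith) (by ring)
        rw [hu0]; simpa using this
      · subst hZ00
        have := hAC W 0 X hX le_rfl hW (by linarith)
        rw [hu0]
        have e : X * (0:ℝ) / (W - q * 0) = 0 := by simp
        rw [e] at this; exact this
    · rcases eq_or_lt_of_le (show X ≤ W - q * y by linarith) with hXe | hXl
      · -- `Z = Z₁ = 0`: the `AB`-letter state, an `AB∗AC`-type point with `u = y`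
        have hZe : Z = 0 := by linarith
        subst hZe
        have := hAC W y X hX hy0 hW hXe.le
        have e : X * y / (W - q * y) = uL := by rw [huL]; ring
        rw [e] at this; exact this
      · -- generic: the ruling decomposition
        have hid := uprods_lamfloor_ruling (Z := Z) hX hyp hXl
        rw [← huL] at hid
        have htop : X * y + X * Z + y * Z ≤ y * (W - q * y) := by
          have := mul_le_mul_of_nonneg_right hLy hl.le
          rw [hfl] at this; linarith
        obtain ⟨hθ0, hθ1⟩ := lamfloor_ruling_weight (q := q) (W := W) (by linarith) hyp hXl hZ0 htop
        rw [hid, hL]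
        have hA := hAC W y X hX hy0 hW hXl.le
        have hB := hBC W y X (y * (W - q * y - X) / (X + y)) hX
          (div_nonneg (mul_nonneg hy0 (by linarith)) (by linarith)) hy0 hW
          (by rw [div_le_iff₀ (by linarith : (0:ℝ) < X + y)]; nlinarith)
          (by have hs : (X + y) ≠ 0 := by linarith
              field_simp
              ring)
        exact add_nonneg (mul_nonneg (sub_nonneg.2 hθ1) hA) (mul_nonneg hθ0 hB)

end ThreeApex

end FK

end Summit.CriticalPhenomena.PercolationContinuityZ3.Theorems
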